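import Literature.AlgebraicGeometry.HodgeTheory.WeilClassesFieldPolynomialMatricesDecomposable
import Literature.AlgebraicGeometry.HodgeTheory.WeilClassesFieldQuaternionOverRealFieldMatricesDecomposable
import HarnessLib

/-!
# Moonen–Zarhin's Criterion (2), types 1 AND 2 FROM MATRIX ENTRIES: an endomorphism of `A^{n+1}` whose entries lie in
# the subring `ℤ⟨Γ⟩ ⊆ End(A)` acts on `H¹` inside `ℂ⟨(⊕γ)^*, (πₐ ≫ ι_b)^*⟩`; for `Γ = {ψ}` (type 1) and
# `Γ = {ψ, α, β}` (type 2) its Weil classes are decomposable, hence algebraic (Moonen–Zarhin 1998 §1)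

Layer `Literature/AlgebraicGeometry/HodgeTheory`; THEOREMS ONLY — no definition, no named fact, no `sorry` (D-0026, net
debt 0).  Generalises the seat's `WeilClassesFieldPolynomialMatricesDecomposable` (entries `p(ψ)`) to entries in the
subring generated by any `Γ ⊆ End(A)`, and discharges the hypothesis `hF` of BOTH rows
(`WeilClassesFieldRealMultiplicationMatricesDecomposable`, `WeilClassesFieldQuaternionOverRealFieldMatricesDecomposable`)
from data on `End(A^{n+1}) = M_{n+1}(End A)`.

## The print

B. J. J. Moonen, Yu. G. Zarhin, *Weil classes on abelian varieties*, J. reine angew. Math. 496 (1998) 83–92 =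
arXiv:alg-geom/9612017 [MoonenZarhin1998WeilClasses] (held text `paper:arxiv-alg-geom_9612017`), §1 Table 1 (chunk
p0002 L60–L84): `X = Y^m`, `End⁰(X) = M_m(End⁰ Y)`; Type 1: `B = M_m(E)`, Type 2: `B = M_m(D)`; §1 Criterion (2) and
its proof (chunk p0003 L46–L90): «suppose that `F ⊆ B` … `G_div(X) ⊆ Sl_F(V_X)`, hence `G_div(X)` acts trivially on
`W_F`».

## What is proved (`X = A^{n+1}`, on `H¹(X(ℂ); ℂ)`; `e_{ab} = (πₐ ≫ ι_b)^*`)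

* (private) pull-back on `H¹` is a ring antihomomorphism and the diagonal `g ↦ g ⊕ ⋯ ⊕ g` a ring homomorphism
  (`0`, `𝟙`, `+`, `-`, `≫`).
* **`pullbackOne_biproductMap_const_mem_adjoin_of_mem_closure`** — `g ∈ ℤ⟨Γ⟩ ⟹ (⊕g)^* ∈ ℂ⟨(⊕γ)^* : γ ∈ Γ⟩`.
* **`pullbackOne_mem_adjoin_diagonal_of_entry_mem_closure`** — entries `ιₐ ≫ φ ≫ π_b ∈ ℤ⟨Γ⟩` ⟹
  `φ^* ∈ ℂ⟨(⊕γ)^*, e_{ab}⟩`; specialisations `…_singleton` (`Γ = {ψ}`) and `…_triple` (`Γ = {ψ, α, β}`) landing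
  exactly in the generator sets of the two rows.
* **`weilClassesField_biproduct_le_divisorClassesSpan/algebraicClasses_of_entry_mem_closure_singleton`** (type 1) and
  **`…_of_entry_mem_closure_quaternionOver`** (type 2): the rows with `hF` replaced by the entries.

Scope (honest column).  Integral entries (subrings of `End(A)`, no denominators: `ℚ(φ) = ℚ(Nφ)`, not restated);
everything else as in the two rows (any `A`, no `End⁰` identification, no algebraic groups).

## References

* [MoonenZarhin1998WeilClasses] B. J. J. Moonen, Yu. G. Zarhin, Weil classes on abelian varieties, J. reine angew.
  Math. 496 (1998) 83–92; arXiv:alg-geom/9612017: §1 Table 1 (chunk p0002 L60–L84), Criterion (2) and its proof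
  (chunk p0003 L46–L90).
* [Milne1999LefschetzClasses] J. S. Milne, Lefschetz classes on abelian varieties, Duke Math. J. 96 (1999), §1 p. 643,
  Thm. 3.2, Cor. 4.5.
* [LangeBirkenhake1992] H. Lange, Ch. Birkenhake, Complex Abelian Varieties (1992), §1.1, §5.1.
* [McconnellRobson2001] J. C. McConnell, J. C. Robson, Noncommutative Noetherian Rings, GSM 30 (AMS 2001), 3.5.5–3.5.7.
* [VoisinHodgeI2002] C. Voisin, Hodge Theory and Complex Algebraic Geometry I (CUP 2002), Thm. 11.30.

## Provenance

Lane `lit-hodgefound` (Track 2, Layer A), prover seat `lit-hodgefound-p21` (generation 21), row g21-#7.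
-/

noncomputable section

open CategoryTheory CategoryTheory.Limits
open Literature.AlgebraicTopology.SingularHomology
open Literature.AlgebraicGeometry.Motives
open Literature.AlgebraicGeometry.VanGeemen1994 (hodgeClassSpan pullbackOne)
open Literature.AlgebraicGeometry.Milne1999
open Literature.AlgebraicGeometry.Pohlmann1968 (sum_map_π_map_ι map_biproductMap_map_π)
open Literature.Geometry.Kaehler (lefschetzPow)
open Literature.Barriers.HodgeConjecture (divisorClassesSpan)
open Literature.LinearAlgebra
open Polynomial

namespace Literature.AlgebraicGeometry.HodgeTheory

section EntriesInSubring

variable {A : AbelianVariety ℂ} {h : complexBetti A.X 2} {n : ℕ} {ψ α β : A ⟶ A} {qa qb : ℂ[X]}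
  {φ : ⨁ (fun _ : Fin (n + 1) => A) ⟶ ⨁ (fun _ : Fin (n + 1) => A)} {P Q : Polynomial ℤ} {e m : ℕ}

/-! #### (private) pull-back on `H¹` is a ring antihomomorphism -/

/-- `(f ≫ g)^* = f^* ∘ g^*`. [folklore] -/
private theorem pb_comp {Y : AbelianVariety ℂ} (f g : Y ⟶ Y) :
    pullbackOne Y (f ≫ g) = pullbackOne Y f * pullbackOne Y g := by
  change (complexBetti.map (f.hom.hom.hom ≫ g.hom.hom.hom) 1).hom = _
  rw [complexBetti.map_comp, ModuleCat.hom_comp]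
  rfl

/-- `0^* = 0`. [folklore] -/
private theorem pb_zero {Y : AbelianVariety ℂ} : pullbackOne Y (0 : Y ⟶ Y) = 0 := by
  change (complexBetti.map (0 : Y ⟶ Y).hom.hom.hom 1).hom = 0
  rw [complexBetti_map_zero_one, ModuleCat.hom_zero]

/-- `(f + g)^* = f^* + g^*`. [folklore] -/
private theorem pb_add {Y : AbelianVariety ℂ} (f g : Y ⟶ Y) :
    pullbackOne Y (f + g) = pullbackOne Y f + pullbackOne Y g := by
  change (complexBetti.map (f + g).hom.hom.hom 1).hom = _
  rw [complexBetti_map_add_one, ModuleCat.hom_add]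

/-- `(-f)^* = -f^*`. [folklore] -/
private theorem pb_neg {Y : AbelianVariety ℂ} (f : Y ⟶ Y) : pullbackOne Y (-f) = -pullbackOne Y f := by
  change (complexBetti.map (-f).hom.hom.hom 1).hom = _
  rw [complexBetti_map_neg_one, ModuleCat.hom_neg]

/-- `𝟙^* = 1`. [folklore] -/
private theorem pb_id {Y : AbelianVariety ℂ} : pullbackOne Y (𝟙 Y) = 1 := by
  refine LinearMap.ext fun v ↦ ?_
  change singularCohomology.map ℂ ℂ (Motives.AlgPoints.mapContinuous (L := ℂ) (𝟙 Y : Y ⟶ Y).hom.hom.hom) 1 v = v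
  exact abelianVariety_map_id_apply v

/-! #### (private) the diagonal `g ↦ g ⊕ ⋯ ⊕ g` is a ring homomorphism `End(A) → End(A^{n+1})` -/

/-- [folklore] -/
private theorem bmap_zero : (biproduct.map fun _ : Fin (n + 1) => (0 : A ⟶ A)) = 0 :=
  biproduct.hom_ext _ _ fun j ↦ by rw [biproduct.map_π, Limits.comp_zero, Limits.zero_comp]

/-- [folklore] -/
private theorem bmap_id : (biproduct.map fun _ : Fin (n + 1) => 𝟙 A) = 𝟙 (⨁ (fun _ : Fin (n + 1) => A)) :=
  biproduct.hom_ext _ _ fun j ↦ by rw [biproduct.map_π, Category.comp_id, Category.id_comp]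

/-- [folklore] -/
private theorem bmap_add (f g : A ⟶ A) : (biproduct.map fun _ : Fin (n + 1) => f + g) =
    (biproduct.map fun _ : Fin (n + 1) => f) + biproduct.map fun _ : Fin (n + 1) => g :=
  biproduct.hom_ext _ _ fun j ↦ by
    rw [biproduct.map_π, Preadditive.add_comp, biproduct.map_π, biproduct.map_π, Preadditive.comp_add]

/-- [folklore] -/
private theorem bmap_neg (f : A ⟶ A) : (biproduct.map fun _ : Fin (n + 1) => -f) =
    -biproduct.map fun _ : Fin (n + 1) => f :=
  biproduct.hom_ext _ _ fun j ↦ by rw [biproduct.map_π, Preadditive.neg_comp, biproduct.map_π, Preadditive.comp_neg]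

/-- [folklore] -/
private theorem bmap_comp (f g : A ⟶ A) : (biproduct.map fun _ : Fin (n + 1) => f ≫ g) =
    (biproduct.map fun _ : Fin (n + 1) => f) ≫ biproduct.map fun _ : Fin (n + 1) => g :=
  biproduct.hom_ext _ _ fun j ↦ by
    rw [biproduct.map_π, Category.assoc, biproduct.map_π, biproduct.map_π_assoc]

/-- **The diagonal is a ring homomorphism `End(A) → End(A^{n+1})` composed with the antihomomorphism `g ↦ g^*`**: for
every `g` in the subring of `End(A)` generated by `Γ`, the diagonal `(g ⊕ ⋯ ⊕ g)^*` lies in the complex algebra generated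
by the diagonals `(γ ⊕ ⋯ ⊕ γ)^*`, `γ ∈ Γ` (induction on the subring: `0`, `𝟙`, `+`, `-`, `≫` are preserved by the
diagonal and, up to order, by pull-back). [cite: LangeBirkenhake1992, §1.1] [cite: MoonenZarhin1998WeilClasses, §1 Table 1 («End⁰(X) = M_m(End⁰ Y) ⊇ End⁰ Y»; chunk p0002 L60–L84)] -/
theorem pullbackOne_biproductMap_const_mem_adjoin_of_mem_closure (Γ : Set (CategoryTheory.End A))
    {g : CategoryTheory.End A} (hg : g ∈ Subring.closure Γ) :
    pullbackOne (⨁ (fun _ : Fin (n + 1) => A)) (biproduct.map fun _ : Fin (n + 1) => End.asHom g) ∈ Algebra.adjoin ℂ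
      ((fun γ : CategoryTheory.End A ↦ pullbackOne (⨁ (fun _ : Fin (n + 1) => A))
        (biproduct.map fun _ : Fin (n + 1) => End.asHom γ)) '' Γ) := by
  induction hg using Subring.closure_induction with
  | mem x hx => exact Algebra.subset_adjoin ⟨x, hx, rfl⟩
  | zero =>
    have e : pullbackOne (⨁ (fun _ : Fin (n + 1) => A))
        (biproduct.map fun _ : Fin (n + 1) => End.asHom (0 : CategoryTheory.End A)) = 0 :=
      (congrArg _ bmap_zero).trans pb_zero
    rw [e]
    exact Subalgebra.zero_mem _
  | one =>
    have e : pullbackOne (⨁ (fun _ : Fin (n + 1) => A))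
        (biproduct.map fun _ : Fin (n + 1) => End.asHom (1 : CategoryTheory.End A)) = 1 :=
      (congrArg _ bmap_id).trans pb_id
    rw [e]
    exact Subalgebra.one_mem _
  | add x y _ _ hx hy =>
    have e : pullbackOne (⨁ (fun _ : Fin (n + 1) => A)) (biproduct.map fun _ : Fin (n + 1) => End.asHom (x + y)) =
        pullbackOne (⨁ (fun _ : Fin (n + 1) => A)) (biproduct.map fun _ : Fin (n + 1) => End.asHom x) +
          pullbackOne (⨁ (fun _ : Fin (n + 1) => A)) (biproduct.map fun _ : Fin (n + 1) => End.asHom y) :=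
      (congrArg _ (bmap_add (End.asHom x) (End.asHom y))).trans (pb_add _ _)
    rw [e]
    exact Subalgebra.add_mem _ hx hy
  | neg x _ hx =>
    have e : pullbackOne (⨁ (fun _ : Fin (n + 1) => A)) (biproduct.map fun _ : Fin (n + 1) => End.asHom (-x)) =
        -pullbackOne (⨁ (fun _ : Fin (n + 1) => A)) (biproduct.map fun _ : Fin (n + 1) => End.asHom x) :=
      (congrArg _ (bmap_neg (End.asHom x))).trans (pb_neg _)
    rw [e]
    exact Subalgebra.neg_mem _ hx
  | mul x y _ _ hx hy =>
    have e : pullbackOne (⨁ (fun _ : Fin (n + 1) => A)) (biproduct.map fun _ : Fin (n + 1) => End.asHom (x * y)) =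
        pullbackOne (⨁ (fun _ : Fin (n + 1) => A)) (biproduct.map fun _ : Fin (n + 1) => End.asHom y) *
          pullbackOne (⨁ (fun _ : Fin (n + 1) => A)) (biproduct.map fun _ : Fin (n + 1) => End.asHom x) :=
      (congrArg _ (bmap_comp (End.asHom y) (End.asHom x))).trans (pb_comp _ _)
    rw [e]
    exact Subalgebra.mul_mem _ hy hx

/-- **A MATRIX WITH ENTRIES IN THE SUBRING `ℤ⟨Γ⟩ ⊆ End(A)` LIES IN `ℂ⟨(⊕γ)^*, e_{ab}⟩`.** If every entry
`ιₐ ≫ φ ≫ π_b` of `φ ∈ End(A^{n+1})` lies in the subring generated by `Γ ⊆ End(A)` — `φ ∈ M_{n+1}(ℤ⟨Γ⟩)` — then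
`φ^* = Σ_{a,b} (⊕φ_{ab})^* e_{ab}` lies in the complex algebra generated by the diagonals `(⊕γ)^*` (`γ ∈ Γ`) and the
matrix units `e_{ab} = (πₐ ≫ ι_b)^*`. [cite: MoonenZarhin1998WeilClasses, §1 Table 1 and proof of Criterion (2) («F ⊆ B = M_m(End⁰ Y)»; chunk p0002 L60–L84, p0003 L82–L90)]
[cite: McconnellRobson2001, 3.5.5–3.5.7] -/
theorem pullbackOne_mem_adjoin_diagonal_of_entry_mem_closure (Γ : Set (CategoryTheory.End A))
    (hφ : ∀ a b, End.of (biproduct.ι (fun _ : Fin (n + 1) => A) a ≫ φ ≫ biproduct.π (fun _ : Fin (n + 1) => A) b) ∈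
      Subring.closure Γ) :
    pullbackOne (⨁ (fun _ : Fin (n + 1) => A)) φ ∈ Algebra.adjoin ℂ
      ((fun γ : CategoryTheory.End A ↦ pullbackOne (⨁ (fun _ : Fin (n + 1) => A))
          (biproduct.map fun _ : Fin (n + 1) => End.asHom γ)) '' Γ ∪
        Set.range fun ab : Fin (n + 1) × Fin (n + 1) ↦ pullbackOne (⨁ (fun _ : Fin (n + 1) => A))
          (biproduct.π (fun _ : Fin (n + 1) => A) ab.1 ≫ biproduct.ι (fun _ : Fin (n + 1) => A) ab.2)) := by
  rw [pullbackOne_eq_sum_biproductMap_entry_mul_π_comp_ι φ]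
  refine Subalgebra.sum_mem _ fun ab _ ↦ Subalgebra.mul_mem _ ?_ (Algebra.subset_adjoin (Or.inr ⟨ab, rfl⟩))
  exact Algebra.adjoin_mono Set.subset_union_left
    (pullbackOne_biproductMap_const_mem_adjoin_of_mem_closure Γ (hφ ab.1 ab.2))

/-- Type 1: entries in `ℤ⟨ψ⟩ = ℤ[ψ]` ⟹ `φ^* ∈ ℂ⟨(⊕ψ)^*, e_{ab}⟩` — the hypothesis `hF` of
`weilClassesField_biproduct_le_divisorClassesSpan_of_mem_adjoin_diagonal`. [cite: MoonenZarhin1998WeilClasses, §1 Table 1, Type 1 («B = M_m(E)»; chunk p0002 L60–L84)] -/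
theorem pullbackOne_mem_adjoin_diagonal_of_entry_mem_closure_singleton
    (hφ : ∀ a b, End.of (biproduct.ι (fun _ : Fin (n + 1) => A) a ≫ φ ≫ biproduct.π (fun _ : Fin (n + 1) => A) b) ∈
      Subring.closure {End.of ψ}) :
    pullbackOne (⨁ (fun _ : Fin (n + 1) => A)) φ ∈ Algebra.adjoin ℂ
      (insert (pullbackOne (⨁ (fun _ : Fin (n + 1) => A)) (biproduct.map fun _ : Fin (n + 1) => ψ))
        (Set.range fun ab : Fin (n + 1) × Fin (n + 1) ↦ pullbackOne (⨁ (fun _ : Fin (n + 1) => A))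
          (biproduct.π (fun _ : Fin (n + 1) => A) ab.1 ≫ biproduct.ι (fun _ : Fin (n + 1) => A) ab.2))) := by
  refine Algebra.adjoin_mono ?_ (pullbackOne_mem_adjoin_diagonal_of_entry_mem_closure _ hφ)
  rintro _ (⟨γ, hγ, rfl⟩ | ⟨ab, rfl⟩)
  · rw [Set.mem_singleton_iff.1 hγ]
    exact Set.mem_insert _ _
  · exact Set.mem_insert_of_mem _ ⟨ab, rfl⟩

/-- Type 2: entries in `ℤ⟨ψ, α, β⟩` (non-commutative polynomials in the centre `ψ` and the quaternion pair `α, β`) ⟹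
`φ^* ∈ ℂ⟨(⊕ψ)^*, (⊕α)^*, (⊕β)^*, e_{ab}⟩` — the hypothesis `hF` of
`weilClassesField_biproduct_le_divisorClassesSpan_of_mem_adjoin_quaternionOver_diagonal`. [cite: MoonenZarhin1998WeilClasses, §1 Table 1, Type 2 («B = M_m(D)»; chunk p0002 L60–L84)] -/
theorem pullbackOne_mem_adjoin_diagonal_of_entry_mem_closure_triple
    (hφ : ∀ a b, End.of (biproduct.ι (fun _ : Fin (n + 1) => A) a ≫ φ ≫ biproduct.π (fun _ : Fin (n + 1) => A) b) ∈
      Subring.closure {End.of ψ, End.of α, End.of β}) :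
    pullbackOne (⨁ (fun _ : Fin (n + 1) => A)) φ ∈ Algebra.adjoin ℂ
      (insert (pullbackOne (⨁ (fun _ : Fin (n + 1) => A)) (biproduct.map fun _ : Fin (n + 1) => ψ))
        (insert (pullbackOne (⨁ (fun _ : Fin (n + 1) => A)) (biproduct.map fun _ : Fin (n + 1) => α))
          (insert (pullbackOne (⨁ (fun _ : Fin (n + 1) => A)) (biproduct.map fun _ : Fin (n + 1) => β))
            (Set.range fun ab : Fin (n + 1) × Fin (n + 1) ↦ pullbackOne (⨁ (fun _ : Fin (n + 1) => A))
              (biproduct.π (fun _ : Fin (n + 1) => A) ab.1 ≫ biproduct.ι (fun _ : Fin (n + 1) => A) ab.2))))) := by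
  refine Algebra.adjoin_mono ?_ (pullbackOne_mem_adjoin_diagonal_of_entry_mem_closure _ hφ)
  rintro _ (⟨γ, hγ, rfl⟩ | ⟨ab, rfl⟩)
  · rcases hγ with rfl | rfl | hγ
    · exact Set.mem_insert _ _
    · exact Set.mem_insert_of_mem _ (Set.mem_insert _ _)
    · rw [Set.mem_singleton_iff.1 hγ]
      exact Set.mem_insert_of_mem _ (Set.mem_insert_of_mem _ (Set.mem_insert _ _))
  · exact Set.mem_insert_of_mem _ (Set.mem_insert_of_mem _ (Set.mem_insert_of_mem _ ⟨ab, rfl⟩))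

/-- **THE TYPE-1 ROW FROM MATRIX ENTRIES: `W_F(A^{n+1}) ⊗ ℂ ≤ 𝒟ᵐ ⊗ ℂ` for `F = ℚ(φ)`, `φ ∈ M_{n+1}(ℤ[ψ])`** (`ψ` a
Rosati-symmetric real multiplication with irreducible minimal polynomial; hypotheses as in
`weilClassesField_biproduct_le_divisorClassesSpan_of_mem_adjoin_diagonal`, with `hF` replaced by: every entry
`ιₐ ≫ φ ≫ π_b` lies in the subring `ℤ⟨ψ⟩ ⊆ End(A)`). [cite: MoonenZarhin1998WeilClasses, §1 Criterion (2) and its proof, type 1 (chunk p0003 L46–L90)]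
[cite: Milne1999LefschetzClasses, §1 p. 643, Thm. 3.2, Cor. 4.5] -/
theorem weilClassesField_biproduct_le_divisorClassesSpan_of_entry_mem_closure_singleton (hA : 0 < A.dim)
    (hh : h ∈ hodgeClassSpan A.dim A.X 1) (htop : lefschetzPow h (A.dim - 1) 2 h ≠ 0)
    (hnd : ∀ x : complexBetti A.X 1, (∀ y, polarizationPairingOne A.X h (A.dim - 1) x y = 0) → x = 0)
    (hψsym : ∀ v w : complexBetti A.X 1, polarizationPairingOne A.X h (A.dim - 1) (pullbackOne A ψ v) w =
      polarizationPairingOne A.X h (A.dim - 1) v (pullbackOne A ψ w))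
    (hQm : Q.Monic) (hQirr : Irreducible (Q.map (Int.castRingHom ℚ)))
    (hψQ : Polynomial.eval₂ (Int.castRingHom (CategoryTheory.End A)) (ψ : CategoryTheory.End A) Q = 0)
    (hPm : P.Monic) (hPe : P.natDegree = e) (hPirr : Irreducible (P.map (Int.castRingHom ℚ)))
    (hφ : Polynomial.eval₂ (Int.castRingHom (CategoryTheory.End (⨁ (fun _ : Fin (n + 1) => A))))
      (φ : CategoryTheory.End (⨁ (fun _ : Fin (n + 1) => A))) P = 0)
    (her : e * (2 * m) = 2 * ((n + 1) * A.dim))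
    (hφe : ∀ a b, End.of (biproduct.ι (fun _ : Fin (n + 1) => A) a ≫ φ ≫ biproduct.π (fun _ : Fin (n + 1) => A) b) ∈
      Subring.closure {End.of ψ}) :
    weilClassesField (⨁ (fun _ : Fin (n + 1) => A)) φ P (2 * m) ≤
      divisorClassesSpan (⨁ (fun _ : Fin (n + 1) => A)).X (⨁ (fun _ : Fin (n + 1) => A)).dim m :=
  weilClassesField_biproduct_le_divisorClassesSpan_of_mem_adjoin_diagonal hA hh htop hnd hψsym hQm hQirr hψQ hPm hPe
    hPirr hφ her (pullbackOne_mem_adjoin_diagonal_of_entry_mem_closure_singleton hφe)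

/-- **… and algebraic: THE WEIL CLASSES OF `ℚ(φ)`, `φ ∈ M_{n+1}(ℤ[ψ]) ⊆ End(A^{n+1})`, ARE ALGEBRAIC.**
[cite: MoonenZarhin1998WeilClasses, Introduction (chunk p0001 L10–L18) and §1 Criterion (2) (chunk p0003 L46–L90)] [cite: VoisinHodgeI2002, Thm. 11.30] -/
theorem weilClassesField_biproduct_le_algebraicClasses_of_entry_mem_closure_singleton (hA : 0 < A.dim)
    (hh : h ∈ hodgeClassSpan A.dim A.X 1) (htop : lefschetzPow h (A.dim - 1) 2 h ≠ 0)
    (hnd : ∀ x : complexBetti A.X 1, (∀ y, polarizationPairingOne A.X h (A.dim - 1) x y = 0) → x = 0)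
    (hψsym : ∀ v w : complexBetti A.X 1, polarizationPairingOne A.X h (A.dim - 1) (pullbackOne A ψ v) w =
      polarizationPairingOne A.X h (A.dim - 1) v (pullbackOne A ψ w))
    (hQm : Q.Monic) (hQirr : Irreducible (Q.map (Int.castRingHom ℚ)))
    (hψQ : Polynomial.eval₂ (Int.castRingHom (CategoryTheory.End A)) (ψ : CategoryTheory.End A) Q = 0)
    (hPm : P.Monic) (hPe : P.natDegree = e) (hPirr : Irreducible (P.map (Int.castRingHom ℚ)))
    (hφ : Polynomial.eval₂ (Int.castRingHom (CategoryTheory.End (⨁ (fun _ : Fin (n + 1) => A))))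
      (φ : CategoryTheory.End (⨁ (fun _ : Fin (n + 1) => A))) P = 0)
    (her : e * (2 * m) = 2 * ((n + 1) * A.dim))
    (hφe : ∀ a b, End.of (biproduct.ι (fun _ : Fin (n + 1) => A) a ≫ φ ≫ biproduct.π (fun _ : Fin (n + 1) => A) b) ∈
      Subring.closure {End.of ψ}) :
    weilClassesField (⨁ (fun _ : Fin (n + 1) => A)) φ P (2 * m) ≤ algebraicClasses (⨁ (fun _ : Fin (n + 1) => A)).X m :=
  weilClassesField_biproduct_le_algebraicClasses_of_mem_adjoin_diagonal hA hh htop hnd hψsym hQm hQirr hψQ hPm hPe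
    hPirr hφ her (pullbackOne_mem_adjoin_diagonal_of_entry_mem_closure_singleton hφe)

/-- **THE TYPE-2 ROW FROM MATRIX ENTRIES: `W_F(A^{n+1}) ⊗ ℂ ≤ 𝒟ᵐ ⊗ ℂ` for `F = ℚ(φ)`, `φ ∈ M_{n+1}(ℤ⟨ψ, α, β⟩)`**
(`ℚ(ψ)⟨α, β⟩` a quaternion algebra over the real-multiplication centre; hypotheses as in
`weilClassesField_biproduct_le_divisorClassesSpan_of_mem_adjoin_quaternionOver_diagonal`, with `hF` replaced by: every
entry `ιₐ ≫ φ ≫ π_b` lies in the subring `ℤ⟨ψ, α, β⟩ ⊆ End(A)`). [cite: MoonenZarhin1998WeilClasses, §1 Criterion (2) and its proof, type 2 (chunk p0003 L46–L90); Tables 1–2 (chunk p0002 L60–L118)]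
[cite: Milne1999LefschetzClasses, §1 p. 643, Thm. 3.2, Cor. 4.5] -/
theorem weilClassesField_biproduct_le_divisorClassesSpan_of_entry_mem_closure_quaternionOver (hA : 0 < A.dim)
    (hh : h ∈ hodgeClassSpan A.dim A.X 1) (htop : lefschetzPow h (A.dim - 1) 2 h ≠ 0)
    (hnd : ∀ x : complexBetti A.X 1, (∀ y, polarizationPairingOne A.X h (A.dim - 1) x y = 0) → x = 0)
    (hψsym : ∀ v w : complexBetti A.X 1, polarizationPairingOne A.X h (A.dim - 1) (pullbackOne A ψ v) w =
      polarizationPairingOne A.X h (A.dim - 1) v (pullbackOne A ψ w))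
    (hQm : Q.Monic) (hQirr : Irreducible (Q.map (Int.castRingHom ℚ)))
    (hψQ : Polynomial.eval₂ (Int.castRingHom (CategoryTheory.End A)) (ψ : CategoryTheory.End A) Q = 0)
    (hα2 : pullbackOne A α * pullbackOne A α = aeval (pullbackOne A ψ) qa)
    (hqa : ∀ z : ℂ, (Q.map (Int.castRingHom ℂ)).IsRoot z → qa.eval z ≠ 0)
    (hβ2 : pullbackOne A β * pullbackOne A β = aeval (pullbackOne A ψ) qb)
    (hqb : ∀ z : ℂ, (Q.map (Int.castRingHom ℂ)).IsRoot z → qb.eval z ≠ 0)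
    (hanti : pullbackOne A α * pullbackOne A β = -(pullbackOne A β * pullbackOne A α))
    (hαsym : ∀ v w : complexBetti A.X 1, polarizationPairingOne A.X h (A.dim - 1) (pullbackOne A α v) w =
      polarizationPairingOne A.X h (A.dim - 1) v (pullbackOne A α w))
    (hβsym : ∀ v w : complexBetti A.X 1, polarizationPairingOne A.X h (A.dim - 1) (pullbackOne A β v) w =
      polarizationPairingOne A.X h (A.dim - 1) v (pullbackOne A β w))
    (hψα : pullbackOne A ψ * pullbackOne A α = pullbackOne A α * pullbackOne A ψ)
    (hψβ : pullbackOne A ψ * pullbackOne A β = pullbackOne A β * pullbackOne A ψ)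
    (hPm : P.Monic) (hPe : P.natDegree = e) (hPirr : Irreducible (P.map (Int.castRingHom ℚ)))
    (hφ : Polynomial.eval₂ (Int.castRingHom (CategoryTheory.End (⨁ (fun _ : Fin (n + 1) => A))))
      (φ : CategoryTheory.End (⨁ (fun _ : Fin (n + 1) => A))) P = 0)
    (her : e * (2 * m) = 2 * ((n + 1) * A.dim))
    (hφe : ∀ a b, End.of (biproduct.ι (fun _ : Fin (n + 1) => A) a ≫ φ ≫ biproduct.π (fun _ : Fin (n + 1) => A) b) ∈
      Subring.closure {End.of ψ, End.of α, End.of β}) :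
    weilClassesField (⨁ (fun _ : Fin (n + 1) => A)) φ P (2 * m) ≤
      divisorClassesSpan (⨁ (fun _ : Fin (n + 1) => A)).X (⨁ (fun _ : Fin (n + 1) => A)).dim m :=
  weilClassesField_biproduct_le_divisorClassesSpan_of_mem_adjoin_quaternionOver_diagonal hA hh htop hnd hψsym hQm
    hQirr hψQ hα2 hqa hβ2 hqb hanti hαsym hβsym hψα hψβ hPm hPe hPirr hφ her
    (pullbackOne_mem_adjoin_diagonal_of_entry_mem_closure_triple hφe)

/-- **… and algebraic: THE WEIL CLASSES OF `ℚ(φ)`, `φ ∈ M_{n+1}(ℤ⟨ψ, α, β⟩) ⊆ End(A^{n+1})`, ARE ALGEBRAIC.**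
[cite: MoonenZarhin1998WeilClasses, Introduction (chunk p0001 L10–L18) and §1 Criterion (2) (chunk p0003 L46–L90)] [cite: VoisinHodgeI2002, Thm. 11.30] -/
theorem weilClassesField_biproduct_le_algebraicClasses_of_entry_mem_closure_quaternionOver (hA : 0 < A.dim)
    (hh : h ∈ hodgeClassSpan A.dim A.X 1) (htop : lefschetzPow h (A.dim - 1) 2 h ≠ 0)
    (hnd : ∀ x : complexBetti A.X 1, (∀ y, polarizationPairingOne A.X h (A.dim - 1) x y = 0) → x = 0)
    (hψsym : ∀ v w : complexBetti A.X 1, polarizationPairingOne A.X h (A.dim - 1) (pullbackOne A ψ v) w =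
      polarizationPairingOne A.X h (A.dim - 1) v (pullbackOne A ψ w))
    (hQm : Q.Monic) (hQirr : Irreducible (Q.map (Int.castRingHom ℚ)))
    (hψQ : Polynomial.eval₂ (Int.castRingHom (CategoryTheory.End A)) (ψ : CategoryTheory.End A) Q = 0)
    (hα2 : pullbackOne A α * pullbackOne A α = aeval (pullbackOne A ψ) qa)
    (hqa : ∀ z : ℂ, (Q.map (Int.castRingHom ℂ)).IsRoot z → qa.eval z ≠ 0)
    (hβ2 : pullbackOne A β * pullbackOne A β = aeval (pullbackOne A ψ) qb)
    (hqb : ∀ z : ℂ, (Q.map (Int.castRingHom ℂ)).IsRoot z → qb.eval z ≠ 0)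
    (hanti : pullbackOne A α * pullbackOne A β = -(pullbackOne A β * pullbackOne A α))
    (hαsym : ∀ v w : complexBetti A.X 1, polarizationPairingOne A.X h (A.dim - 1) (pullbackOne A α v) w =
      polarizationPairingOne A.X h (A.dim - 1) v (pullbackOne A α w))
    (hβsym : ∀ v w : complexBetti A.X 1, polarizationPairingOne A.X h (A.dim - 1) (pullbackOne A β v) w =
      polarizationPairingOne A.X h (A.dim - 1) v (pullbackOne A β w))
    (hψα : pullbackOne A ψ * pullbackOne A α = pullbackOne A α * pullbackOne A ψ)
    (hψβ : pullbackOne A ψ * pullbackOne A β = pullbackOne A β * pullbackOne A ψ)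
    (hPm : P.Monic) (hPe : P.natDegree = e) (hPirr : Irreducible (P.map (Int.castRingHom ℚ)))
    (hφ : Polynomial.eval₂ (Int.castRingHom (CategoryTheory.End (⨁ (fun _ : Fin (n + 1) => A))))
      (φ : CategoryTheory.End (⨁ (fun _ : Fin (n + 1) => A))) P = 0)
    (her : e * (2 * m) = 2 * ((n + 1) * A.dim))
    (hφe : ∀ a b, End.of (biproduct.ι (fun _ : Fin (n + 1) => A) a ≫ φ ≫ biproduct.π (fun _ : Fin (n + 1) => A) b) ∈
      Subring.closure {End.of ψ, End.of α, End.of β}) :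
    weilClassesField (⨁ (fun _ : Fin (n + 1) => A)) φ P (2 * m) ≤ algebraicClasses (⨁ (fun _ : Fin (n + 1) => A)).X m :=
  weilClassesField_biproduct_le_algebraicClasses_of_mem_adjoin_quaternionOver_diagonal hA hh htop hnd hψsym hQm
    hQirr hψQ hα2 hqa hβ2 hqb hanti hαsym hβsym hψα hψβ hPm hPe hPirr hφ her
    (pullbackOne_mem_adjoin_diagonal_of_entry_mem_closure_triple hφe)

end EntriesInSubring

end Literature.AlgebraicGeometry.HodgeTheory

end
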